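import Summits.QuantumAdvantage.QuantumAdvantage.Theorems.CubicForrelationNearExactIsExactTwelveLevelFive930Residual
import Summits.QuantumAdvantage.QuantumAdvantage.Theorems.CubicForrelationNearExactIsExactTwelveTypeO931Shape

/-!
# Crux `CubicForrelation.NearExactIsExact` (stmt-QuantumAdvantage-14043) — n = 12: NO level-5 side at `Φ ≥ 930/1024`
  (the value `930/1024` included)

Certificate seat `b2b-cforr-cert` (gen 20).  HONEST FRAMING: a kernel-checked THEOREM (standard axioms) about cubic Boolean pairs on 12 bits — one of
the three configurations of the next undecided value `930/1024 = 465/512` on the `n = 12` ladder (the others: type O with base set `992` and zero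
excess, and level `≥ 6` × level `≥ 6` at `Σ e² = 752`); it does NOT by itself produce a new value of `θ₁₂`.  NOT summit progress.

THEOREM `tw20_levelFive_ge930_false`: cubic `f, g : 𝔽₂¹² → 𝔽₂` with `W_g = 32·u'`, some `u'(x)` odd, and `Φ(f,g) ≥ 930/1024` do not exist.
Proof (HOME/b2b-cforr-cert-g20/PROOF-N12-930-L5.md).  By `tw20_levelFive_ge930_residual`: `u' = 2(−1)^f + 1_P(σ + 8r)` with `Σ r² ≤ 20`,
`r̂(y) = Σ r(x)(−1)^{x·y}`, `|r̂| ≤ 20`, `Σ_y r̂² ≤ 81920`; `Ŝ = 64m`, `m(y) ∈ {0, ±16, ±32}`, `m ≢ 0`; and the partner's spectrum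
`W_f(y) = 64(−1)^{g(y)} − 32 m(y) − 4 r̂(y)`.  Ax for `f`: `W_f = 16·u_f`, so `r̂ = 4q` with `q = 4(−1)^g − 2m − u_f ∈ ℤ`, `|q| ≤ 5`.
* `f` type O (`u_f` odd somewhere, hence everywhere): `to19_typeO_ge930_shape` for the pair `(g, f)` gives `#E_f = 992` and
  `Σ_y (u_f − 4(−1)^g)² = 12032 = 4096 + 8·992` for `E_f = {u_f ≡ ±1 (8)}`; since `τ = u_f − 4(−1)^g = −2m − q` is odd with `|τ| ≥ 3` on `E_f`,
  every `τ² ≤ 9`, so `|2m| ≤ 3 + 5`, `|m| ≤ 4`, `m ≡ 0` — contradiction.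
* `u_f` even: `f` is at level `≥ 5` with `u_f/2 = 2(−1)^g − m − q/2`.  If `u_f/2` is odd somewhere, its odd set is a hyperplane
  (`tw20_hyperplane_930le` for `(g, f)`), on which `q/2` is odd, `|r̂| = 4|q| ≥ 8`: `Σ r̂² ≥ 2048·64 > 81920`.  If `u_f/2` is even everywhere,
  `f` is at level `≥ 6`, `u_f/4 = (−1)^g − m/2 − q/4`: either `u_f/4` is odd everywhere — `f` is bent-like (`Σ (u_f/4)² = 4096`), and `tw_bent_end`
  gives `Φ ∈ {1} ∪ [0, 7/8]`, impossible — or its even set has `≥ 512` points (Reed–Muller on the cubic parity, `stub_walshTower`), where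
  `q/4` is odd-minus-even… precisely `2(−1)^g − m − 2(u_f/4) ≡ 2 (mod 4)`, so `|r̂| ≥ 16`: `Σ r̂² ≥ 512·256 > 81920`.  Contradiction in all cases.

References: J. Ax (1964) / R. J. McEliece (1972); O. S. Rothaus (1976); MacWilliams–Sloane (1977) Ch. 13 §3, Ch. 14, Ch. 15 §2; C. Carlet (2021)
§4.1, §5.2, §6.1.  Everything below is proved from Mathlib and the tree; axioms are the standard three.
-/

set_option linter.dupNamespace false -- D-0017: single-problem summit ⇒ `QuantumAdvantage.QuantumAdvantage` by design

noncomputable section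

namespace Summit.QuantumAdvantage.QuantumAdvantage.Theorems.CubicForrelation.NearExactIsExact

open Finset
open Literature.Computability.QuantumComplexity
open Literature.Computability.QuantumComplexity.BuzetChailloux (bxor zeroVec bxor_zeroVec zeroVec_bxor bxor_comm twist_zeroVec_right twist_bxor_right)
open Literature.Computability.QuantumComplexity.DerivativeWalsh (W sum_W_sq)
open Literature.Computability.QuantumComplexity.Simon (twist_eq_one_or twist_mul_self)

/-- **No level-5 side at `Φ ≥ 930/1024` on 12 bits.**  See the module docstring.  Finite-slice statement, NOT summit progress. [this work] -/
theorem tw20_levelFive_ge930_false (f g : (Fin (6 + 6) → Bool) → Bool) (hf : IsDegLeFun 3 f) (hg : IsDegLeFun 3 g)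
    (u' : (Fin (6 + 6) → Bool) → ℤ) (hu' : ∀ x, W (fun y => signOf (g y)) x = (2 : ℝ) ^ 5 * (u' x : ℝ))
    (hodd : ∃ x, Odd (u' x)) (hΦ : (930 / 1024 : ℝ) ≤ forrelation f g) : False := by
  classical
  obtain ⟨γ, tg, D, r, m, htg, hγ0, hPg, hD, hroff, hu'form, hr20, hrabs, hrpars, hgran, hmne, hm, hWf, hΦlt⟩ :=
    tw20_levelFive_ge930_residual f g hf hg u' hu' hodd hΦ
  have hΦ' : forrelation g f = forrelation f g := by
    rw [Summit.QuantumAdvantage.QuantumAdvantage.Theorems.SignedCubicForrelationNotPrBPP.Negative.HalfQuad.forrelation_comm]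
  have hlo' : (930 / 1024 : ℝ) ≤ forrelation g f := by rw [hΦ']; exact hΦ
  have hmeven : ∀ y, Even (m y) := by
    intro y
    rcases hgran y with h | h | h
    · rw [h]; exact ⟨0, rfl⟩
    · rcases abs_eq (by norm_num : (0 : ℤ) ≤ 16) |>.1 h with h' | h' <;> rw [h'] <;> decide
    · rcases abs_eq (by norm_num : (0 : ℤ) ≤ 32) |>.1 h with h' | h' <;> rw [h'] <;> decide
  have hm4 : ∀ y, (4 : ℤ) ∣ m y := by
    intro y
    rcases hgran y with h | h | h
    · rw [h]; exact dvd_zero _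
    · rcases abs_eq (by norm_num : (0 : ℤ) ≤ 16) |>.1 h with h' | h' <;> rw [h'] <;> decide
    · rcases abs_eq (by norm_num : (0 : ℤ) ≤ 32) |>.1 h with h' | h' <;> rw [h'] <;> decide
  -- Ax for `f` at level 4, and the integer `q = r̂/4`
  obtain ⟨uf, huf⟩ := tw_base (n := 6 + 6) f hf 4 (by norm_num)
  set ρ : (Fin (6 + 6) → Bool) → ℝ := fun y => ∑ x, (r x : ℝ) * twist x y with hρdef
  set q : (Fin (6 + 6) → Bool) → ℤ := fun y => 4 * sZ (g y) - 2 * m y - uf y with hqdef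
  have hρq : ∀ y, ρ y = 4 * (q y : ℝ) := by
    intro y
    have h1 := hWf y
    have h2 := huf y
    simp only [q]
    push_cast
    rw [tp_sZ_cast]
    change W (fun x => signOf (f x)) y = 64 * signOf (g y) - 32 * (m y : ℝ) - 4 * ρ y at h1
    rw [show (2 : ℝ) ^ 4 = 16 by norm_num] at h2
    linarith
  have hq5 : ∀ y, |q y| ≤ 5 := by
    intro y
    have h := hrabs y
    change |ρ y| ≤ 20 at h
    rw [hρq y, abs_mul, abs_of_nonneg (by norm_num : (0 : ℝ) ≤ 4)] at h
    have : |(q y : ℝ)| ≤ 5 := by linarith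
    rw [← Int.cast_abs] at this
    exact_mod_cast this
  -- `ρ² ≥ c` on a set of size `N` with `c·N > 81920` is impossible
  have hbig : ∀ (S : Finset (Fin (6 + 6) → Bool)) (c : ℝ), 0 ≤ c → (∀ y ∈ S, c ≤ ρ y ^ 2) → c * #S ≤ 81920 := by
    intro S c hc hS
    have h1 : ∑ y ∈ S, c ≤ ∑ y ∈ S, ρ y ^ 2 := sum_le_sum hS
    rw [sum_const, nsmul_eq_mul, mul_comm] at h1
    have h2 : ∑ y ∈ S, ρ y ^ 2 ≤ ∑ y, ρ y ^ 2 := sum_le_sum_of_subset_of_nonneg (subset_univ S) fun y _ _ => sq_nonneg _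
    have h3 : ∑ y, ρ y ^ 2 ≤ 81920 := hrpars
    linarith
  by_cases hO : ∃ y, Odd (uf y)
  · /- `f` is type O: zero excess forces `|u_f − 4(−1)^g| ≤ 3`, hence `m ≡ 0` -/
    obtain ⟨y₁, hy₁⟩ := hO
    obtain ⟨hE, hex, -⟩ := to19_typeO_ge930_shape g f hg hf uf huf ⟨y₁, hy₁⟩ hlo'
    -- all `u_f` odd (the parity is constant at level 4)
    have hdeg := stub_walshTower stub_axParity (6 + 6) 4 0 f uf hf huf (by intro k hk hkn; omega)
    have hallodd : ∀ y, Odd (uf y) := by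
      intro y
      have h := tc_const_of_deg_zero hdeg y y₁
      have h1 : decide (Odd (uf y₁)) = true := by simpa using hy₁
      rw [h1] at h
      simpa using h
    set E := univ.filter (fun y : Fin (6 + 6) → Bool => (Odd (uf y / 2) ↔ Odd (uf y / 2 / 2))) with hEdef
    set τ : (Fin (6 + 6) → Bool) → ℤ := fun y => uf y - 4 * sZ (g y) with hτdef
    have hτ1 : ∀ y, 1 ≤ τ y ^ 2 := by
      intro y
      have h0 := Int.odd_iff.1 (hallodd y)
      have : τ y ≤ -1 ∨ 1 ≤ τ y := by
        simp only [τ]; rcases tp_sZ_cases (g y) with hs | hs <;> rw [hs] <;> omega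
      have := tp_sq_ge (k := 1) (by norm_num) this
      linarith
    have hτ9 : ∀ y ∈ E, 9 ≤ τ y ^ 2 := by
      intro y hy
      have hE' : (Odd (uf y / 2) ↔ Odd (uf y / 2 / 2)) := (mem_filter.1 hy).2
      have h0 := Int.odd_iff.1 (hallodd y)
      have key : τ y ≤ -3 ∨ 3 ≤ τ y := by
        simp only [τ]
        rw [Int.odd_iff, Int.odd_iff] at hE'
        rcases tp_sZ_cases (g y) with hs | hs <;> rw [hs] <;> omega
      have := tp_sq_ge (k := 3) (by norm_num) key
      linarith
    -- tightness: `Σ τ² = 4096 + 8·992`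
    have hτle : ∀ y, τ y ^ 2 ≤ 9 := by
      have hsplit : (∑ y, τ y ^ 2 : ℤ) = ∑ y ∈ E, τ y ^ 2 + ∑ y ∈ univ.filter (fun y => y ∉ E), τ y ^ 2 := by
        rw [← sum_filter_add_sum_filter_not univ (fun y => y ∈ E)]
        congr 1
        exact sum_congr (by ext y; simp) fun _ _ => rfl
      have hEc : #(univ.filter fun y : Fin (6 + 6) → Bool => y ∉ E) = 4096 - 992 := by
        have h := card_filter_add_card_filter_not (s := (univ : Finset (Fin (6 + 6) → Bool))) (fun y => y ∈ E)
        have e1 : (univ.filter fun y : Fin (6 + 6) → Bool => y ∈ E) = E := by ext y; simp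
        rw [e1, hE, card_univ, Fintype.card_fun, Fintype.card_bool, Fintype.card_fin] at h
        norm_num at h
        omega
      have hsumE : 9 * (992 : ℤ) ≤ ∑ y ∈ E, τ y ^ 2 := by
        have h1 : ∑ y ∈ E, (9 : ℤ) ≤ ∑ y ∈ E, τ y ^ 2 := sum_le_sum hτ9
        rw [sum_const, hE, nsmul_eq_mul] at h1
        norm_num at h1
        linarith
      have hsumC : (3104 : ℤ) ≤ ∑ y ∈ univ.filter (fun y => y ∉ E), τ y ^ 2 := by
        have h1 : ∑ y ∈ univ.filter (fun y => y ∉ E), (1 : ℤ) ≤ ∑ y ∈ univ.filter (fun y => y ∉ E), τ y ^ 2 :=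
          sum_le_sum fun y _ => hτ1 y
        rw [sum_const, hEc, nsmul_eq_mul] at h1
        norm_num at h1
        exact h1
      have htot : (∑ y, τ y ^ 2 : ℤ) = 12032 := hex
      intro y
      by_contra hgt
      push Not at hgt
      -- odd square above 9 is at least 25
      have h25 : 25 ≤ τ y ^ 2 := by
        have h0 := Int.odd_iff.1 (hallodd y)
        have h3 : τ y ≤ -4 ∨ 4 ≤ τ y := by
          by_contra h; push Not at h; nlinarith [h.1, h.2]
        have : τ y ≤ -5 ∨ 5 ≤ τ y := by
          simp only [τ] at h3 ⊢; rcases tp_sZ_cases (g y) with hs | hs <;> rw [hs] at h3 ⊢ <;> omega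
        have := tp_sq_ge (k := 5) (by norm_num) this
        linarith
      by_cases hyE : y ∈ E
      · have hsplitE := add_sum_erase E (fun z => τ z ^ 2) hyE
        have hrest : 9 * ((#E : ℤ) - 1) ≤ ∑ z ∈ E.erase y, τ z ^ 2 := by
          have h1 : ∑ z ∈ E.erase y, (9 : ℤ) ≤ ∑ z ∈ E.erase y, τ z ^ 2 := sum_le_sum fun z hz => hτ9 z (mem_of_mem_erase hz)
          rw [sum_const, card_erase_of_mem hyE, nsmul_eq_mul, hE] at h1
          rw [hE]; norm_num at h1 ⊢; linarith
        rw [hE] at hrest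
        norm_num at hrest
        linarith [hsumC, hsplit, htot]
      · have hyc : y ∈ univ.filter (fun z : Fin (6 + 6) → Bool => z ∉ E) := mem_filter.2 ⟨mem_univ _, hyE⟩
        have hsplitC := add_sum_erase (univ.filter (fun z : Fin (6 + 6) → Bool => z ∉ E)) (fun z => τ z ^ 2) hyc
        have hrest : ((4096 - 992 : ℕ) : ℤ) - 1 ≤ ∑ z ∈ (univ.filter (fun z : Fin (6 + 6) → Bool => z ∉ E)).erase y, τ z ^ 2 := by
          have h1 : ∑ z ∈ (univ.filter (fun z : Fin (6 + 6) → Bool => z ∉ E)).erase y, (1 : ℤ) ≤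
              ∑ z ∈ (univ.filter (fun z : Fin (6 + 6) → Bool => z ∉ E)).erase y, τ z ^ 2 := sum_le_sum fun z _ => hτ1 z
          rw [sum_const, card_erase_of_mem hyc, nsmul_eq_mul, mul_one, hEc] at h1
          push_cast [show 1 ≤ 4096 - 992 by norm_num] at h1 ⊢
          linarith
        norm_num at hrest
        linarith [hsumE, hsplit, htot]
    -- `|τ| ≤ 3` and `τ = −2m − q` with `|q| ≤ 5` force `|m| ≤ 4`, hence `m = 0`
    have hm0 : ∀ y, m y = 0 := by
      intro y
      have h1 := hτle y
      have h2 := hq5 y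
      have hτq : τ y = -2 * m y - q y := by simp only [τ, q]; ring
      rw [abs_le] at h2
      have h3 : τ y ≤ 3 ∧ -3 ≤ τ y := by constructor <;> nlinarith
      rcases hgran y with h | h | h
      · exact h
      · exfalso; rcases abs_eq (by norm_num : (0 : ℤ) ≤ 16) |>.1 h with h' | h' <;> rw [h'] at hτq <;> omega
      · exfalso; rcases abs_eq (by norm_num : (0 : ℤ) ≤ 32) |>.1 h with h' | h' <;> rw [h'] at hτq <;> omega
    obtain ⟨y₀, hy₀⟩ := hmne
    exact hy₀ (hm0 y₀)
  · /- `u_f` even: `f` at level `≥ 5` -/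
    push Not at hO
    have huf5 := tw_level_up (j := 4) f uf huf hO
    have hev2 : ∀ y, uf y = 2 * (uf y / 2) := fun y =>
      (Int.mul_ediv_cancel' (even_iff_two_dvd.1 (Int.not_odd_iff_even.1 (hO y)))).symm
    -- `ρ = 8 (2(−1)^g − m − u_f/2)`
    have hρ5 : ∀ y, ρ y = 8 * ((2 * sZ (g y) - m y - uf y / 2 : ℤ) : ℝ) := by
      intro y
      rw [hρq y]
      simp only [q]
      have h := hev2 y
      push_cast
      have h' : ((uf y : ℤ) : ℝ) = 2 * ((uf y / 2 : ℤ) : ℝ) := by exact_mod_cast h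
      rw [h']
      ring
    by_cases hO5 : ∃ y, Odd (uf y / 2)
    · /- level exactly 5: the odd set is a hyperplane, and `ρ² ≥ 64` there -/
      obtain ⟨γ', t', ht', hγ'0, hPf⟩ := tw20_hyperplane_930le g f hf (fun y => uf y / 2) huf5 hO5 hlo'
      have hcard := tw59_card_half γ' hγ'0 t' ht'
      have h64 : ∀ y ∈ univ.filter (fun y : Fin (6 + 6) → Bool => twist γ' y = t'), (64 : ℝ) ≤ ρ y ^ 2 := by
        intro y hy
        have hyo : Odd (uf y / 2) := (hPf y).2 (mem_filter.1 hy).2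
        rw [hρ5 y]
        have hne : (2 * sZ (g y) - m y - uf y / 2 : ℤ) ≤ -1 ∨ 1 ≤ (2 * sZ (g y) - m y - uf y / 2 : ℤ) := by
          obtain ⟨k, hk⟩ := hmeven y
          have h0 := Int.odd_iff.1 hyo
          rcases tp_sZ_cases (g y) with hs | hs <;> rw [hs] <;> omega
        have hsq := tp_sq_ge (k := 1) (by norm_num) hne
        have : (1 : ℝ) ≤ ((2 * sZ (g y) - m y - uf y / 2 : ℤ) : ℝ) ^ 2 := by exact_mod_cast hsq
        nlinarith
      have := hbig _ 64 (by norm_num) h64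
      rw [hcard] at this
      norm_num at this
    · /- level ≥ 6 -/
      push Not at hO5
      have huf6 := tw_level_up (j := 5) f (fun y => uf y / 2) huf5 hO5
      have hev4 : ∀ y, uf y / 2 = 2 * (uf y / 2 / 2) := fun y =>
        (Int.mul_ediv_cancel' (even_iff_two_dvd.1 (Int.not_odd_iff_even.1 (hO5 y)))).symm
      set u6 : (Fin (6 + 6) → Bool) → ℤ := fun y => uf y / 2 / 2 with hu6def
      have huf6' : ∀ y, W (fun x => signOf (f x)) y = (2 : ℝ) ^ 6 * (u6 y : ℝ) := fun y => huf6 y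
      have hρ6 : ∀ y, ρ y = 8 * ((2 * sZ (g y) - m y - 2 * u6 y : ℤ) : ℝ) := by
        intro y; rw [hρ5 y, hev4 y]
      by_cases hall : ∀ y, Odd (u6 y)
      · /- `f` bent-like: `Φ ∈ {1} ∪ [0, 7/8]` -/
        set u4 : (Fin (6 + 6) → Bool) → ℤ := fun y => 4 * u6 y with hu4def
        have hu4 : ∀ y, W (fun x => signOf (f x)) y = (2 : ℝ) ^ 4 * (u4 y : ℝ) := by
          intro y; rw [huf6' y]; simp only [u4]; push_cast; ring
        have hpar : ∑ y, u6 y ^ 2 = 4096 := by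
          have h := zms_sum_u_sq 2 f u4 (fun y => (hu4 y).trans (by norm_num))
          have e : ∑ y, ((u4 y : ℝ)) ^ 2 = 16 * ∑ y, ((u6 y : ℝ)) ^ 2 := by
            rw [mul_sum]; exact sum_congr rfl fun y _ => by simp only [u4]; push_cast; ring
          rw [e] at h
          norm_num at h
          have h' : ∑ y, ((u6 y : ℝ)) ^ 2 = 4096 := by linarith
          exact_mod_cast h'
        have hsq1' : ∀ y, u6 y ^ 2 = 1 := by
          have hge : ∀ y, (1 : ℤ) ≤ u6 y ^ 2 := fun y => by
            have h0 := Int.odd_iff.1 (hall y)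
            have : u6 y ≤ -1 ∨ 1 ≤ u6 y := by omega
            have := tp_sq_ge (k := 1) (by norm_num) this
            linarith
          have hsum0 : ∑ y, (u6 y ^ 2 - 1 : ℤ) = 0 := by
            rw [sum_sub_distrib, hpar, sum_const, card_univ, Fintype.card_fun, Fintype.card_bool, Fintype.card_fin]; norm_num
          intro y
          have := (sum_eq_zero_iff_of_nonneg fun z _ => by have := hge z; linarith).1 hsum0 y (mem_univ y)
          linarith
        have hbent : ∀ y, W (fun x => signOf (f x)) y ^ 2 = (2 : ℝ) ^ (6 + 6) := by
          intro y
          rw [huf6' y, mul_pow]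
          have : ((u6 y : ℝ)) ^ 2 = 1 := by exact_mod_cast hsq1' y
          rw [this]; norm_num
        rcases tw_bent_end (by norm_num) g f hg hf hbent with h | h
        · rw [hΦ'] at h; rw [h] at hΦlt; exact lt_irrefl _ hΦlt
        · rw [hΦ'] at h; norm_num at h; linarith
      · /- the even set of `u6` has `≥ 512` points, and `ρ² ≥ 256` there -/
        push Not at hall
        obtain ⟨y₁, hy₁⟩ := hall
        have hp : IsDegLeFun 3 (fun y => decide (Odd (u6 y))) :=
          stub_walshTower stub_axParity (6 + 6) 6 3 f u6 hf huf6' (by intro k hk hkn; omega)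
        have hp' : IsDegLeFun (2 + 1) (fun y => decide (Odd (u6 y)) ^^ true) := tb_isDegLeFun_xor_const hp true
        have hne : ∃ y, (decide (Odd (u6 y)) ^^ true) = true := ⟨y₁, by simpa using hy₁⟩
        have hRM := bb_rmWeight_holds (6 + 6) 3 (fun y => decide (Odd (u6 y)) ^^ true) hp' hne
        set Z := univ.filter (fun y : Fin (6 + 6) → Bool => (decide (Odd (u6 y)) ^^ true) = true) with hZdef
        have hZge : 512 ≤ #Z := by norm_num at hRM; omega
        have h256 : ∀ y ∈ Z, (256 : ℝ) ≤ ρ y ^ 2 := by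
          intro y hy
          have hye : ¬ Odd (u6 y) := by have := (mem_filter.1 hy).2; simpa using this
          obtain ⟨k, hk⟩ := Int.not_odd_iff_even.1 hye
          obtain ⟨k4, hk4⟩ := hm4 y
          rw [hρ6 y]
          have hne : (2 * sZ (g y) - m y - 2 * u6 y : ℤ) ≤ -2 ∨ 2 ≤ (2 * sZ (g y) - m y - 2 * u6 y : ℤ) := by
            rcases tp_sZ_cases (g y) with hs | hs <;> rw [hs] <;> omega
          have hsq := tp_sq_ge (k := 2) (by norm_num) hne
          have : (4 : ℝ) ≤ ((2 * sZ (g y) - m y - 2 * u6 y : ℤ) : ℝ) ^ 2 := by exact_mod_cast hsq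
          nlinarith
        have := hbig Z 256 (by norm_num) h256
        have hZge' : (512 : ℝ) ≤ (#Z : ℝ) := by exact_mod_cast hZge
        linarith

/-- **Packaging at `Fin 12`**: no cubic pair on 12 bits with `W_g = 32u'`, `u'` odd somewhere, has `Φ ≥ 930/1024`. [this work] -/
theorem levelFive_ge_930_false_twelve : ∀ f g : (Fin 12 → Bool) → Bool, IsDegLeFun 3 f → IsDegLeFun 3 g →
    ∀ u' : (Fin 12 → Bool) → ℤ, (∀ x, W (fun y => signOf (g y)) x = 32 * (u' x : ℝ)) → (∃ x, Odd (u' x)) →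
    (930 / 1024 : ℝ) ≤ forrelation f g → False :=
  fun f g hf hg u' hu' hodd hΦ => tw20_levelFive_ge930_false f g hf hg u' (fun x => (hu' x).trans (by norm_num)) hodd hΦ

end Summit.QuantumAdvantage.QuantumAdvantage.Theorems.CubicForrelation.NearExactIsExact

end
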